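import Literature.MathematicalPhysics.QuantumLattice.GrassmannReflectionPositivity
import Literature.MathematicalPhysics.QuantumLattice.GrassmannGaussianPairing
import Literature.MathematicalPhysics.QuantumLattice.GrassmannParity
import HarnessLib

/-!
# Site-reflection positivity on a Grassmann algebra: the zero-time slice

Theorem-only companion of `GrassmannReflectionPositivity.lean` (antilinear reflections `Θ`, the
cone expansion, the top pairing for a LINK reflection `σ(P) = Pᶜ`) and of
`GrassmannGaussianPairing.lean` (the Gaussian pairing `∫ e^{ψ̄Aψ} ψ_I ψ̄_J^{rev}` is a minor, and
the minors of a positive matrix form a positive matrix).  A SITE reflection of lattice fermions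
(Montvay–Münster 1994 §4.2.3, (4.99)–(4.111); Lüscher 1977) has, besides the positive-time block
`P` of generators and its mirror image `N = σ(P)`, a block `Z` of generators living IN the
reflection hyperplane (the time slice `t = 0`), mapped to itself.  For a monomial reflection
(`Θ θ_i = ε_i θ_{σ i}`) this file proves:

* `berezin_basis_mul_map_basis_mul_eq_zero_of_not_top` — **support**: for monomials `θ_a`, `θ_b`
  without `N`-variables and `y` in the slice algebra `Λ_Z`, `∫ θ_a · Θθ_b · y = 0` unless both
  `a ⊇ P` and `b ⊇ P` (counting the `P`- and the `N`-variables of the integrand);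
* `berezin_mul_map_mul_eq_top` — **reduction to the slice**: for `G₁, G₂` without `N`-variables
  and `E ∈ Λ_Z`,
  `∫ G₁ · ΘG₂ · E = c_N ∫ θ_P θ_N · (∫dθ_P G₁) · Θ(∫dθ_P G₂) · E` (`Θθ_P = c_N θ_N`):
  integrating out the positive- and negative-time variables leaves the pairing of the TOP
  `P`-coefficients, two elements of the slice algebra (Montvay–Münster (4.105)–(4.108): the
  functions `𝓘_F[ξ, η]` of the time-zero variables);
* `map_pairing_gaussian_eq` — **the slice is a Gaussian pairing**: if the slice variables are the
  images `u_k = Λφ(ψ_k)`, `Θ u_k = Λφ(ψ̄_k)` of the generators of a standard fermionic algebra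
  `Λ(ψ̄, ψ)` under an algebra map `Λφ`, and a linear functional `λ` restricts along `Λφ` to a
  multiple of the Berezin integral, then
  `λ((Σ c_I u_I) · Θ(Σ d_J u_J) · Λφ(e^{ψ̄Aψ})) = C (−1)^{n(n−1)/2} det A Σ c_I conj d_J Γ(−A⁻¹)_{IJ}`
  (Montvay–Münster (4.108)–(4.110));
* `sum_mul_conj_mul_Gamma_nonneg` — `Σ_{I,J} c_I conj c_J Γ(Q)_{IJ} ≥ 0` for `Q` positive
  semidefinite (`Γ(Qᵀ) = Γ(Q)ᵀ`, `Gamma_transpose`).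

References: I. Montvay, G. Münster, *Quantum Fields on a Lattice* (CUP 1994) §4.2.3; M. Lüscher,
Commun. Math. Phys. 54 (1977) 283; K. Osterwalder, E. Seiler, Ann. Phys. 110 (1978) 440 §§2–3.
Everything here is proved; no named fact is introduced. [folklore]
-/

noncomputable section

open scoped ComplexConjugate ComplexOrder

namespace Literature.MathematicalPhysics.QuantumLattice

namespace GrassmannAlgebra

open ExteriorAlgebra

variable {ι : Type*} [LinearOrder ι] [Fintype ι]

/-! ### Vanishing Berezin integrals by support -/

/-- A product of three monomials whose supports do not cover all generators has no top
component. [folklore] -/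
theorem berezin_basis_mul_basis_mul_basis_eq_zero {a b d : Finset ι} (h : a ∪ b ∪ d ≠ Finset.univ) :
    berezin ℂ ι (grassmannBasis ℂ ι a * grassmannBasis ℂ ι b * grassmannBasis ℂ ι d) = 0 := by
  classical
  by_cases hab : Disjoint a b
  · rw [grassmannBasis_mul_grassmannBasis_of_disjoint ℂ hab, smul_mul_assoc, map_smul]
    by_cases habd : Disjoint (a ∪ b) d
    · rw [grassmannBasis_mul_grassmannBasis_of_disjoint ℂ habd, map_smul,
        berezin_grassmannBasis_of_ne ℂ h, smul_zero, smul_zero]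
    · rw [grassmannBasis_mul_grassmannBasis_of_not_disjoint ℂ habd, map_zero, smul_zero]
  · rw [grassmannBasis_mul_grassmannBasis_of_not_disjoint ℂ hab, zero_mul, map_zero]

/-- Linear extension of the previous lemma in the third factor over a spectator subalgebra.
[folklore] -/
theorem berezin_basis_mul_basis_mul_eq_zero_of_mem {a b s : Finset ι}
    (h : ∀ d, Disjoint d s → a ∪ b ∪ d ≠ Finset.univ) {y : GrassmannAlgebra ℂ ι}
    (hy : y ∈ spectatorSubalgebra ℂ s) :
    berezin ℂ ι (grassmannBasis ℂ ι a * grassmannBasis ℂ ι b * y) = 0 := by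
  rw [mem_spectatorSubalgebra_iff] at hy
  induction hy using Submodule.span_induction with
  | mem x hx =>
    obtain ⟨d, hd, rfl⟩ := hx
    exact berezin_basis_mul_basis_mul_basis_eq_zero (h d hd)
  | zero => rw [mul_zero, map_zero]
  | add x y _ _ hx hy => rw [mul_add, map_add, hx, hy, add_zero]
  | smul c x _ hx => rw [mul_smul_comm, map_smul, hx, smul_zero]

/-- Coefficients of a spectator of `s` vanish on monomials meeting `s`. [folklore] -/
theorem repr_eq_zero_of_mem_spectatorSubalgebra_of_not_disjoint {s : Finset ι}
    {G : GrassmannAlgebra ℂ ι} (hG : G ∈ spectatorSubalgebra ℂ s) {u : Finset ι}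
    (hu : ¬ Disjoint u s) : (grassmannBasis ℂ ι).repr G u = 0 := by
  rw [mem_spectatorSubalgebra_iff, Module.Basis.mem_span_image] at hG
  by_contra hne
  exact hu (hG (Finsupp.mem_support_iff.2 hne))

/-! ### Monomial reflections with a fixed slice -/

section Slice

variable (Θ : Reflection ι) {σ : ι → ι} {ε : ι → ℂ} {P N : Finset ι}

/-- **Support of the site-reflection pairing.** Let `Θ θ_i = ε_i θ_{σ i}` with `σ` injective,
`σ(P) = N`, `P ∩ N = ∅`, and `σ` preserving the slice `Z = (P ∪ N)ᶜ`.  For monomials `θ_a, θ_b`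
free of `N`-variables and `y ∈ Λ_Z`, `∫ θ_a · Θθ_b · y = 0` unless `P ⊆ a` and `P ⊆ b`: the
`P`-variables of the integrand are those of `θ_a`, its `N`-variables those of `Θθ_{b ∩ P}`.
[folklore] -/
theorem berezin_basis_mul_map_basis_mul_eq_zero_of_not_top
    (hΘ : ∀ i, Θ (gen ℂ i) = ε i • gen ℂ (σ i)) (hσ : Function.Injective σ)
    (hPN : P.image σ = N) (hdisj : Disjoint P N) (hZ : ∀ i, i ∉ P ∪ N → σ i ∉ P ∪ N)
    {a b : Finset ι} (ha : Disjoint a N) (hb : Disjoint b N)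
    {y : GrassmannAlgebra ℂ ι} (hy : y ∈ spectatorSubalgebra ℂ (P ∪ N))
    (h : ¬ (P ⊆ a ∧ P ⊆ b)) :
    berezin ℂ ι (grassmannBasis ℂ ι a * Θ (grassmannBasis ℂ ι b) * y) = 0 := by
  classical
  obtain ⟨c, hc⟩ := exists_map_grassmannBasis_eq_smul Θ (P := Finset.univ) (σ := σ) (ε := ε)
    (fun p _ => hΘ p) (hσ.injOn) (Finset.subset_univ b)
  rw [hc, mul_smul_comm, smul_mul_assoc, map_smul,
    berezin_basis_mul_basis_mul_eq_zero_of_mem (fun d hd => ?_) hy, smul_zero]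
  intro huniv
  apply h
  -- the image of `b` avoids `P`
  have hbP : Disjoint (b.image σ) P := by
    rw [Finset.disjoint_left]
    intro j hj hjP
    obtain ⟨i, hi, rfl⟩ := Finset.mem_image.1 hj
    by_cases hiP : i ∈ P
    · exact Finset.disjoint_left.1 hdisj hjP (hPN ▸ Finset.mem_image_of_mem σ hiP)
    · have hiN : i ∉ N := Finset.disjoint_left.1 hb hi
      exact hZ i (by rw [Finset.mem_union, not_or]; exact ⟨hiP, hiN⟩)
        (Finset.mem_union_left _ hjP)
  have hdP : Disjoint d P := Finset.disjoint_of_subset_right Finset.subset_union_left hd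
  have hdN : Disjoint d N := Finset.disjoint_of_subset_right Finset.subset_union_right hd
  constructor
  · intro p hp
    have hp' : p ∈ a ∪ b.image σ ∪ d := huniv ▸ Finset.mem_univ p
    rcases Finset.mem_union.1 hp' with hp'' | hpd
    · rcases Finset.mem_union.1 hp'' with hpa | hpb
      · exact hpa
      · exact absurd hp (Finset.disjoint_left.1 hbP hpb)
    · exact absurd hp (Finset.disjoint_left.1 hdP hpd)
  · -- `N ⊆ σ(b ∩ P)`, whence `|P| = |N| ≤ |b ∩ P|`
    have hNsub : N ⊆ (b ∩ P).image σ := by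
      intro n hn
      have hn' : n ∈ a ∪ b.image σ ∪ d := huniv ▸ Finset.mem_univ n
      rcases Finset.mem_union.1 hn' with hn'' | hnd
      · rcases Finset.mem_union.1 hn'' with hna | hnb
        · exact absurd hn (Finset.disjoint_left.1 ha hna)
        · obtain ⟨i, hi, rfl⟩ := Finset.mem_image.1 hnb
          by_cases hiP : i ∈ P
          · exact Finset.mem_image_of_mem σ (Finset.mem_inter.2 ⟨hi, hiP⟩)
          · have hiN : i ∉ N := Finset.disjoint_left.1 hb hi
            exact absurd (Finset.mem_union_right _ hn)
              (hZ i (by rw [Finset.mem_union, not_or]; exact ⟨hiP, hiN⟩))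
      · exact absurd hn (Finset.disjoint_left.1 hdN hnd)
    have hcard : P.card ≤ (b ∩ P).card := by
      calc P.card = (P.image σ).card := (Finset.card_image_of_injective P hσ).symm
        _ = N.card := by rw [hPN]
        _ ≤ ((b ∩ P).image σ).card := Finset.card_le_card hNsub
        _ ≤ (b ∩ P).card := Finset.card_image_le
    have hbP' : b ∩ P = P := Finset.eq_of_subset_of_card_le Finset.inter_subset_right hcard
    exact fun p hp => (Finset.mem_inter.1 (hbP'.symm ▸ hp)).1

/-- `|N| = |P|`, so `θ_P θ_N` is even and central. [folklore] -/
theorem commute_basis_mul_basis_of_image_eq (hσ : Function.Injective σ) (hPN : P.image σ = N)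
    (hdisj : Disjoint P N) (x : GrassmannAlgebra ℂ ι) :
    Commute (grassmannBasis ℂ ι P * grassmannBasis ℂ ι N) x := by
  classical
  refine commute_of_mem_evenOdd_zero ℂ ?_ x
  rw [grassmannBasis_mul_grassmannBasis_of_disjoint ℂ hdisj]
  refine Submodule.smul_mem _ _ ?_
  have h := grassmannBasis_mem_evenOdd ℂ (P ∪ N)
  have hcard : ((P ∪ N).card : ZMod 2) = 0 := by
    rw [Finset.card_union_of_disjoint hdisj, ← hPN, Finset.card_image_of_injective P hσ,
      ← two_mul, Nat.cast_mul]
    exact mul_eq_zero_of_left (by decide) _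
  rwa [hcard] at h

/-- **Reduction of the site-reflection pairing to the slice.** With `Θ`, `σ`, `P`, `N` as above,
for `G₁, G₂` free of `N`-variables (spectators of `N`: functions of the positive-time and the
slice variables) and a slice element `E ∈ Λ_Z` (in the application the even Gaussian of the slice
action):
`∫ G₁ · ΘG₂ · E = c_N · ∫ θ_P θ_N · (∫dθ_P G₁) · Θ(∫dθ_P G₂) · E`, where `Θ θ_P = c_N θ_N` and
`∫dθ_P = berezinOn P` extracts the top `P`-coefficient (an element of the slice algebra).  This is
Montvay–Münster's passage (4.105)–(4.108) from `⟨F ΘF⟩` to the slice integral of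
`𝓘_F · 𝓘_F^†`. [cite: MontvayMunster1994, §4.2.3 (4.105)–(4.108)] -/
theorem berezin_mul_map_mul_eq_top
    (hΘ : ∀ i, Θ (gen ℂ i) = ε i • gen ℂ (σ i)) (hσ : Function.Injective σ)
    (hPN : P.image σ = N) (hdisj : Disjoint P N) (hZ : ∀ i, i ∉ P ∪ N → σ i ∉ P ∪ N)
    {cN : ℂ} (hcN : Θ (grassmannBasis ℂ ι P) = cN • grassmannBasis ℂ ι N)
    {G₁ G₂ E : GrassmannAlgebra ℂ ι} (hG₁ : G₁ ∈ spectatorSubalgebra ℂ N)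
    (hG₂ : G₂ ∈ spectatorSubalgebra ℂ N) (hE : E ∈ spectatorSubalgebra ℂ (P ∪ N)) :
    berezin ℂ ι (G₁ * Θ G₂ * E) =
      cN * berezin ℂ ι (grassmannBasis ℂ ι P * grassmannBasis ℂ ι N *
        (berezinOn ℂ P G₁ * Θ (berezinOn ℂ P G₂) * E)) := by
  classical
  set β := grassmannBasis ℂ ι with hβ
  -- both sides are sesquilinear in `(G₁, G₂)`: reduce to monomials
  have hterm : ∀ a b : Finset ι, Disjoint a N → Disjoint b N →
      berezin ℂ ι (β a * Θ (β b) * E) =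
        cN * berezin ℂ ι (β P * β N * (berezinOn ℂ P (β a) * Θ (berezinOn ℂ P (β b)) * E)) := by
    intro a b haN hbN
    by_cases htop : P ⊆ a ∧ P ⊆ b
    · obtain ⟨hPa, hPb⟩ := htop
      have haP : a ∩ P = P := Finset.inter_eq_right.2 hPa
      have hbP : b ∩ P = P := Finset.inter_eq_right.2 hPb
      have ha := grassmannBasis_eq_smul_sdiff_mul_inter ℂ a P
      have hb := grassmannBasis_eq_smul_sdiff_mul_inter ℂ b P
      rw [haP] at ha
      rw [hbP] at hb
      have hia : berezinOn ℂ P (β a) = (((berezinSign P a : ℤˣ) : ℤ) : ℂ) • β (a \ P) := by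
        rw [hβ, berezinOn_grassmannBasis, if_pos hPa]
      have hib : berezinOn ℂ P (β b) = (((berezinSign P b : ℤˣ) : ℤ) : ℂ) • β (b \ P) := by
        rw [hβ, berezinOn_grassmannBasis, if_pos hPb]
      have hreal : ∀ s : ℤˣ, conj (((s : ℤ) : ℂ)) = ((s : ℤ) : ℂ) := fun s => by
        rw [map_intCast]
      rw [hia, hib, Θ.map_smul, hreal]
      conv_lhs => rw [hβ, ha, hb, ← hβ]
      rw [Θ.map_smul, hreal, Θ.map_mul, hcN]
      simp only [smul_mul_assoc, mul_smul_comm, map_smul, smul_eq_mul, mul_assoc]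
      have hcomm := commute_basis_mul_basis_of_image_eq (ι := ι) hσ hPN hdisj
      have hkey : ∀ R : GrassmannAlgebra ℂ ι,
          β (a \ P) * (β P * (β N * R)) = β P * (β N * (β (a \ P) * R)) := by
        intro R
        calc β (a \ P) * (β P * (β N * R)) = (β (a \ P) * (β P * β N)) * R := by
              simp only [mul_assoc]
          _ = ((β P * β N) * β (a \ P)) * R := by rw [(hcomm (β (a \ P))).eq]
          _ = β P * (β N * (β (a \ P) * R)) := by simp only [mul_assoc]
      rw [hkey]
      ring
    · rw [berezin_basis_mul_map_basis_mul_eq_zero_of_not_top Θ hΘ hσ hPN hdisj hZ haN hbN hE htop]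
      -- the right-hand side vanishes too: one of the partial integrals is zero
      rcases not_and_or.1 htop with hPa | hPb
      · rw [hβ, berezinOn_grassmannBasis, if_neg hPa, zero_mul, zero_mul, mul_zero, map_zero,
          mul_zero]
      · rw [hβ, berezinOn_grassmannBasis ℂ P b, if_neg hPb, Θ.map_zero, mul_zero, zero_mul,
          mul_zero, map_zero, mul_zero]
  have hG₁e : G₁ = ∑ a, β.repr G₁ a • β a := (β.sum_repr G₁).symm
  have hG₂e : G₂ = ∑ b, β.repr G₂ b • β b := (β.sum_repr G₂).symm
  have hL : berezin ℂ ι (G₁ * Θ G₂ * E) =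
      ∑ a, ∑ b, β.repr G₁ a * conj (β.repr G₂ b) * berezin ℂ ι (β a * Θ (β b) * E) := by
    conv_lhs => rw [hG₁e, hG₂e]
    simp only [map_sum, Θ.map_sum, map_smul, Θ.map_smul, Finset.sum_mul, Finset.mul_sum,
      smul_mul_assoc, mul_smul_comm, smul_eq_mul]
    rw [Finset.sum_comm]
    refine Finset.sum_congr rfl fun a _ => Finset.sum_congr rfl fun b _ => ?_
    ring
  have hR : berezin ℂ ι (β P * β N * (berezinOn ℂ P G₁ * Θ (berezinOn ℂ P G₂) * E)) =
      ∑ a, ∑ b, β.repr G₁ a * conj (β.repr G₂ b) *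
        berezin ℂ ι (β P * β N * (berezinOn ℂ P (β a) * Θ (berezinOn ℂ P (β b)) * E)) := by
    conv_lhs => rw [hG₁e, hG₂e]
    simp only [map_sum, Θ.map_sum, map_smul, Θ.map_smul, Finset.sum_mul, Finset.mul_sum,
      smul_mul_assoc, mul_smul_comm, smul_eq_mul]
    rw [Finset.sum_comm]
    refine Finset.sum_congr rfl fun a _ => Finset.sum_congr rfl fun b _ => ?_
    ring
  rw [hL, hR, Finset.mul_sum]
  refine Finset.sum_congr rfl fun a _ => ?_
  rw [Finset.mul_sum]
  refine Finset.sum_congr rfl fun b _ => ?_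
  by_cases haN : Disjoint a N
  · by_cases hbN : Disjoint b N
    · rw [hterm a b haN hbN]
      ring
    · rw [repr_eq_zero_of_mem_spectatorSubalgebra_of_not_disjoint hG₂ hbN, map_zero, mul_zero,
        zero_mul, zero_mul, mul_zero]
  · rw [repr_eq_zero_of_mem_spectatorSubalgebra_of_not_disjoint hG₁ haN, zero_mul, zero_mul,
      zero_mul, mul_zero]

end Slice

/-! ### The slice pairing is Gaussian -/

section Gaussian

variable (Θ : Reflection ι) {κ : Type*} [LinearOrder κ] [Fintype κ]

omit [LinearOrder ι] [Fintype ι] [Fintype κ] in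
/-- `Θ` of an increasing product of "upper" slice variables `u_k = Λφ(ψ_k)` with `Θu_k = Λφ(ψ̄_k)`
is the image of the decreasing product `ψ̄_J^{rev}`. [folklore] -/
theorem map_map_psiProd (φ : ((κ ⊕ₗ κ) → ℂ) →ₗ[ℂ] (ι → ℂ))
    (hΘu : ∀ k, Θ (ExteriorAlgebra.map φ (psi ℂ k)) = ExteriorAlgebra.map φ (psiBar ℂ k))
    (J : Finset κ) :
    Θ (ExteriorAlgebra.map φ (psiProd κ J)) = ExteriorAlgebra.map φ (psiBarProdRev κ J) := by
  rw [psiProd, psiBarProdRev, map_list_prod, Θ.map_list_prod, map_list_prod]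
  simp only [List.map_map, List.map_reverse]
  congr 2
  exact List.map_congr_left fun k _ => by simp only [Function.comp_apply, hΘu]

omit [LinearOrder ι] [Fintype ι] in
/-- **The slice pairing is a Gaussian pairing of minors.** Let the slice variables be the images
`u_k = Λφ(ψ_k)` of the generators `ψ_k` of a standard fermionic algebra `Λ(ψ̄_κ, ψ_κ)` under the
algebra map `Λφ` of a linear map `φ`, with `Θ u_k = Λφ(ψ̄_k)`, and let the linear functional `λ`
restrict along `Λφ` to `C · ∫dψ̄dψ`.  Then for coefficient families `c, d` and an invertible
coupling matrix `A`,
`λ((Σ_I c_I u_I) · Θ(Σ_J d_J u_J) · Λφ(e^{ψ̄Aψ})) = C (−1)^{n(n−1)/2} det A Σ_{I,J} c_I conj(d_J) Γ(−A⁻¹)_{IJ}`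
(`u_I` the increasing product): Montvay–Münster (4.108)–(4.110), the pairing of the slice functions
through the Gaussian `e^{−S₀}`. [cite: MontvayMunster1994, §4.2.3 (4.108)–(4.110)] -/
theorem map_pairing_gaussian_eq (φ : ((κ ⊕ₗ κ) → ℂ) →ₗ[ℂ] (ι → ℂ))
    (hΘu : ∀ k, Θ (ExteriorAlgebra.map φ (psi ℂ k)) = ExteriorAlgebra.map φ (psiBar ℂ k))
    (lam : GrassmannAlgebra ℂ ι →ₗ[ℂ] ℂ) {C : ℂ}
    (hlam : ∀ y, lam (ExteriorAlgebra.map φ y) = C * berezin ℂ (κ ⊕ₗ κ) y)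
    (A : Matrix κ κ ℂ) (hA : IsUnit A.det) (c d : Finset κ → ℂ) :
    lam ((∑ I, c I • ExteriorAlgebra.map φ (psiProd κ I)) *
          Θ (∑ J, d J • ExteriorAlgebra.map φ (psiProd κ J)) *
          ExteriorAlgebra.map φ (grassmannExp (quadratic ℂ A))) =
      C * ((-1 : ℂ) ^ (Fintype.card κ * (Fintype.card κ - 1) / 2) * A.det *
        ∑ I, ∑ J, c I * conj (d J) * Gamma (-A⁻¹) I J) := by
  have hΘs : Θ (∑ J, d J • ExteriorAlgebra.map φ (psiProd κ J)) =
      ExteriorAlgebra.map φ (∑ J, conj (d J) • psiBarProdRev κ J) := by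
    rw [Θ.map_sum, map_sum]
    refine Finset.sum_congr rfl fun J _ => ?_
    rw [Θ.map_smul, map_map_psiProd Θ φ hΘu, map_smul]
  have hs₁ : (∑ I, c I • ExteriorAlgebra.map φ (psiProd κ I)) =
      ExteriorAlgebra.map φ (∑ I, c I • psiProd κ I) := by
    rw [map_sum]
    simp only [map_smul]
  have hE : Commute (grassmannExp (quadratic ℂ A))
      ((∑ I, c I • psiProd κ I) * (∑ J, conj (d J) • psiBarProdRev κ J)) :=
    commute_of_mem_evenOdd_zero ℂ (grassmannExp_quadratic_mem_evenOdd_zero ℂ A) _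
  rw [hΘs, hs₁, ← map_mul, ← map_mul, ← hE.eq, hlam, berezin_gaussian_pairing A hA]

omit [Fintype κ] in
/-- `Γ(gᵀ) = Γ(g)ᵀ` (minors of the transpose). [folklore] -/
theorem Gamma_transpose (g : Matrix κ κ ℂ) : Gamma g.transpose = (Gamma g).transpose := by
  ext S T
  rw [Matrix.transpose_apply]
  by_cases h : S.card = T.card
  · rw [Gamma_apply_of_card_eq g.transpose h rfl, Gamma_apply_of_card_eq g rfl h,
      ← Matrix.transpose_submatrix, Matrix.det_transpose]
  · rw [Gamma_apply_of_card_ne g.transpose h, Gamma_apply_of_card_ne g (Ne.symm h)]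

/-- **Positivity of the Gaussian slice pairing**: `Σ_{I,J} c_I conj(c_J) Γ(Q)_{IJ} ≥ 0` for `Q`
positive semidefinite (the form of `map_pairing_gaussian_eq` with `d = c`, `Q = −A⁻¹`; Montvay–
Münster (4.109)–(4.110): "`B` positive … this integral is obviously positive"). [cite: MontvayMunster1994, §4.2.3 (4.109)–(4.110)] -/
theorem sum_mul_conj_mul_Gamma_nonneg {Q : Matrix κ κ ℂ} (hQ : Q.PosSemidef) (c : Finset κ → ℂ) :
    0 ≤ ∑ I, ∑ J, c I * conj (c J) * Gamma Q I J := by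
  have h := sum_conj_mul_Gamma_mul_nonneg hQ.transpose c
  rw [Gamma_transpose, Finset.sum_comm] at h
  convert h using 2 with J _
  refine Finset.sum_congr rfl fun I _ => ?_
  rw [Matrix.transpose_apply]
  ring

end Gaussian

end GrassmannAlgebra

end Literature.MathematicalPhysics.QuantumLattice
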